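import Summits.BirchSwinnertonDyer.BirchSwinnertonDyer.Theorems.PrintCFramBottomClassIndexLawFiveLeLevelDictionaryKummer
import Summits.BirchSwinnertonDyer.Rank1Residual.X2.ResidualDevissageModules
import Summits.BirchSwinnertonDyer.BirchSwinnertonDyer.Theorems.PrintCFramBottomClassIndexLawFiveLeHerbrandSelmerToHom
import Summits.BirchSwinnertonDyer.BirchSwinnertonDyer.Theorems.PrintCFramBottomClassIndexLawFiveLeHerbrandLineRestriction
import HarnessLib

/-!
# Route `PrintCFram`, crux C2 `BottomClassIndexLawFiveLe` (stmt-BirchSwinnertonDyer-20372), line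
# `eisenstein-resource-bdp-line` (LEAD g10, report §2(d)): **THE LEVEL DICTIONARY (α), ON THE LINE** — the
# Kummer dichotomy of `…LevelDictionaryKummer` in the currency of the herbrand line's stable lines
# (`X2.ResidualDevissageModules.StableSubgroup`, the `Φ.Sub` / `Φ.Quot` of `HerbrandLineRestriction`,
# `HerbrandSelmerToHomClass`, LEAD g9's swap)
# (cell `bsd-print-cfram`, width seat `bsd-line-cfram-p1-w4` g8; helper `--supports` 20372; 0 defs, 0 facts,
# 0 sorry)

HONEST FRAMING. Nothing about BSD is proved here, and nothing of any stub. `…LevelDictionaryKummer`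
(`unramified_quot_or_sub_of_kummer`) is stated for `GreenbergVatsal2000.StableSubgroup`; the herbrand line's
T2 / T2′ / swap files (`HerbrandLineRestriction.subgroupResKer_ker_eq_bot_sub/quot`,
`HerbrandSelmerToHomClass`, `HerbrandConjugationSwapRational`) use the twin structure
`Summit.BirchSwinnertonDyer.Rank1Residual.X2.ResidualDevissageModules.StableSubgroup`. This file restates
the dichotomy for that structure (same proof: (α-core) `unramified_quot_or_sub_of_locally_trivial` fed with
the Kummer-layer lemmas), so that the consumer can call it on the rational line `Φ = W[𝔭]` of the v15/v16
composition without a conversion.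

* **`unramified_quot_or_sub_of_kummer_line`** — `K` a number field, `W/K` elliptic, `m ≠ 0`, `Φ ≤ W[m]` an
  `X2`-stable subgroup, `mQ = P ∈ W(K)` with `P ∉ m·W(K)`; at every finite place not (good and prime to
  `m`): the Kummer class lies in `torsionLocalKer W K_v m` and `Φ.Quot^{I_𝔓} = 0` for all `𝔓 ∣ v`. Then
  either the push-forward of the Kummer cocycle to `Φ.Quot` has non-zero class and is a coboundary on every
  inertia group `I_𝔓`, or some continuous crossed homomorphism `w : Γ_K → Φ.Sub`, cohomologous to the
  Kummer cocycle inside `W[m]` up to `Φ.incl`, has non-zero class and is a coboundary on every `I_𝔓`.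

* **`hom_of_unramified_class`** — THE HAND-OFF TO THE ENGINES' CURRENCY: for a discrete `Γ_K`-module `A` of
  prime order `p` with continuous orbit maps and non-trivial action, a continuous crossed homomorphism
  `w : Γ_K → A` with non-zero class which is a coboundary on every inertia group `I_𝔓` is, on
  `N = ker(Γ_K → Aut A)` (`= res Γ_{K(A)}`), a continuous additive `Γ_K`-equivariant map killing every
  `N ∩ I_𝔓` and NOT identically zero (T2 `HerbrandLineRestriction.subgroupResKer_ker_eq_bot_of_card_prime` +
  `HerbrandSelmerToHom` §1) — exactly the negation of the conclusion of `ODD(r, N)` / `EVEN`.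

THEOREMS ONLY; no definition, no named fact, no `sorry`. BSD is not proved by any of this; no summit statement
is proved by this seat. References: [SilvermanAEC2009] VIII.§2, X.§4; [GreenbergLNM1716] §3 (PDF p. 86);
[GreenbergVatsal2000] §2 p. 28; [SerreGaloisCohomology1997] I.§2.6 (b), I.§5.1; the LEAD g10 report §2(d).
-/

set_option autoImplicit false
-- `…BirchSwinnertonDyer.BirchSwinnertonDyer.Theorems…` is the problem's mandated namespace (D-0017).
set_option linter.dupNamespace false

noncomputable section

open scoped Classical Pointwise

namespace Summit.BirchSwinnertonDyer.BirchSwinnertonDyer.Theorems.PrintCFram.LevelDictionary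

open NumberField IsDedekindDomain Field WeierstrassCurve
open Literature.NumberTheory.EllipticCurves Literature.NumberTheory.GaloisRepresentations
  Literature.NumberTheory.EllipticCurves.GreenbergSelmer
open Summit.BirchSwinnertonDyer.Rank1Residual

universe u

variable {K : Type u} [Field K] [NumberField K] (W : WeierstrassCurve K) [W.IsElliptic]

/-- **(α-W) THE LEVEL DICTIONARY ON THE LINE** (the herbrand line's `StableSubgroup` currency). `K` a number
field, `W/K` elliptic, `m ≠ 0`, `Φ ≤ W[m]` a `Γ_K`-stable subgroup
(`X2.ResidualDevissageModules.StableSubgroup`, sub `Φ.Sub`, quotient `Φ.Quot`); `Q ∈ W(K̄)` with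
`mQ = P ∈ W(K)` NOT `m`-divisible in `W(K)`; `z = (σ ↦ σQ − Q)` its Kummer cocycle (`kummerCocycleTorsion`).
ASSUME, at every finite place `v` which is not a place of good reduction prime to `m`:
`[z] ∈ torsionLocalKer W K_v m` (LEVEL ≥ 1 at the place above `p`,
`kummerClassTorsion_mem_torsionLocalKer_of_baseChange_eq_zsmul`; automatic at a bad `ℓ ∤ m` with
`W(K_ℓ)[m] = 0`, `mem_torsionLocalKer_adicCompletion_of_forall_nsmul_eq_zero`) and `Φ.Quot` has no non-zero
`I_𝔓`-invariant for every `𝔓 ∣ v`. THEN: EITHER the push-forward of `z` to `Φ.Quot` has NON-ZERO class and is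
a coboundary on the inertia group `I_𝔓 ≤ Γ_K` of EVERY prime `𝔓` of `\bar ℤ_K`, OR there are a continuous
crossed homomorphism `w : Γ_K → Φ.Sub` with NON-ZERO class, a coboundary on every `I_𝔓`, and `m₁ ∈ W[m]` with
`Φ.incl (w g) = z g − (g m₁ − m₁)`. (LEAD g10 report §2(d)(α), `K = ℚ`, `Φ = W[𝔭]`.)
[cite: SilvermanAEC2009, X.§4 (proof of Thm. 4.2(b)) and VIII.§2] [cite: GreenbergLNM1716, §3 (PDF p. 86)] -/
theorem unramified_quot_or_sub_of_kummer_line {m : ℕ} (hm : m ≠ 0)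
    (Φ : X2.ResidualDevissageModules.StableSubgroup (absoluteGaloisGroup K) (geomTorsion W (m : ℤ)))
    (Q : geomPoints W)
    (hQfix : (m : ℤ) • Q ∈ MulAction.fixedPoints (absoluteGaloisGroup K) (geomPoints W))
    (P : W.toAffine.Point) (hQ : (m : ℤ) • Q = toGeomPoints W P)
    (hP : ∀ R : W.toAffine.Point, (m : ℤ) • R ≠ P)
    (hloc : ∀ v : HeightOneSpectrum (𝓞 K), ¬ (W.HasGoodReductionAt v ∧ ((m : ℕ) : 𝓞 K) ∉ v.asIdeal) →
      kummerClassTorsion W (m : ℤ) Q hQfix ∈ W.torsionLocalKer (v.adicCompletion K) (m : ℤ))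
    (hQI : ∀ v : HeightOneSpectrum (𝓞 K), ¬ (W.HasGoodReductionAt v ∧ ((m : ℕ) : 𝓞 K) ∉ v.asIdeal) →
      ∀ 𝔓 ∈ v.primesAbove, ∀ q : Φ.Quot,
        (∀ g ∈ 𝔓.inertia (absoluteGaloisGroup K), g • q = q) → q = 0) :
    (∃ zq : contOneCocycles (discreteTopRep (absoluteGaloisGroup K) Φ.Quot),
      (∀ g, zq.1 g = Φ.proj ((kummerCocycleTorsion W (m : ℤ) Q hQfix).1 g)) ∧
      oneCocycleClass _ zq ≠ 0 ∧
      ∀ (v : HeightOneSpectrum (𝓞 K)) (𝔓 : Ideal (absIntegers (𝓞 K) K)), 𝔓 ∈ v.primesAbove →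
        ∃ q : Φ.Quot, ∀ g ∈ 𝔓.inertia (absoluteGaloisGroup K), zq.1 g = g • q - q) ∨
    (∃ (w : contOneCocycles (discreteTopRep (absoluteGaloisGroup K) Φ.Sub)) (m₁ : geomTorsion W (m : ℤ)),
      oneCocycleClass _ w ≠ 0 ∧
      (∀ (v : HeightOneSpectrum (𝓞 K)) (𝔓 : Ideal (absIntegers (𝓞 K) K)), 𝔓 ∈ v.primesAbove →
        ∃ s : Φ.Sub, ∀ g ∈ 𝔓.inertia (absoluteGaloisGroup K), w.1 g = g • s - s) ∧
      ∀ g, Φ.incl (w.1 g) = (kummerCocycleTorsion W (m : ℤ) Q hQfix).1 g - (g • m₁ - m₁)) := by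
  set z := kummerCocycleTorsion W (m : ℤ) Q hQfix with hz
  -- the family of inertia groups of all primes of `\bar ℤ_K`
  set 𝓘 : Set (Subgroup (absoluteGaloisGroup K)) :=
    {I | ∃ (v : HeightOneSpectrum (𝓞 K)) (𝔓 : Ideal (absIntegers (𝓞 K) K)),
      𝔓 ∈ v.primesAbove ∧ I = 𝔓.inertia (absoluteGaloisGroup K)} with h𝓘
  have hmem : ∀ (v : HeightOneSpectrum (𝓞 K)) (𝔓 : Ideal (absIntegers (𝓞 K) K)), 𝔓 ∈ v.primesAbove →
      𝔓.inertia (absoluteGaloisGroup K) ∈ 𝓘 := fun v 𝔓 h𝔓 ↦ ⟨v, 𝔓, h𝔓, rfl⟩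
  -- the data of (α-core)
  have hπ : ∀ (g : absoluteGaloisGroup K) (x : geomTorsion W (m : ℤ)), Φ.proj (g • x) = g • Φ.proj x :=
    Φ.proj_smul
  have hker : ∀ x : geomTorsion W (m : ℤ), Φ.proj x = 0 → ∃ s : Φ.Sub, Φ.incl s = x := fun x hx ↦ by
    obtain ⟨s, hs⟩ := Φ.mem_range_incl_of_proj_eq_zero x hx
    exact ⟨s, hs⟩
  have hQ𝓘 : ∀ I ∈ 𝓘, (∀ q : Φ.Quot, (∀ g ∈ I, g • q = q) → q = 0) ∨
      (∀ g ∈ I, ∀ x : geomTorsion W (m : ℤ), g • x = x) := by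
    rintro I ⟨v, 𝔓, h𝔓, rfl⟩
    by_cases hgood : W.HasGoodReductionAt v ∧ ((m : ℕ) : 𝓞 K) ∉ v.asIdeal
    · exact Or.inr fun g hg x ↦ W.smul_geomTorsion_eq_of_mem_inertia hgood.1
        (n := (m : ℤ)) (by exact_mod_cast hgood.2) h𝔓 hg x
    · exact Or.inl (hQI v hgood 𝔓 h𝔓)
  have hzne : oneCocycleClass _ z ≠ 0 :=
    kummerClassTorsion_ne_zero_of_forall_zsmul_ne W Q hQfix P hQ hP
  have hzloc : ∀ I ∈ 𝓘, ∃ x : geomTorsion W (m : ℤ), ∀ g ∈ I, z.1 g = g • x - x := by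
    rintro I ⟨v, 𝔓, h𝔓, rfl⟩
    by_cases hgood : W.HasGoodReductionAt v ∧ ((m : ℕ) : 𝓞 K) ∉ v.asIdeal
    · refine ⟨0, fun g hg ↦ ?_⟩
      rw [smul_zero, sub_zero]
      exact kummerCocycleTorsion_apply_eq_zero_of_mem_inertia W Q hQfix hgood.1
        (n := (m : ℤ)) (by exact_mod_cast hgood.2) h𝔓 hg
    · exact coboundaryOn_inertia_of_mem_torsionLocalKer W hm v z (hloc v hgood) h𝔓
  -- (α-core)
  rcases unramified_quot_or_sub_of_locally_trivial (continuous_smul_geomTorsion W (m : ℤ)) Φ.incl Φ.proj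
      Φ.incl_smul hπ Φ.incl_injective Φ.proj_surjective Φ.proj_incl hker 𝓘 hQ𝓘 z hzne hzloc with
    ⟨hq, hqloc⟩ | ⟨w, m₁, hw, hwloc, hwz⟩
  · refine Or.inl ⟨contOneCocycles.pullback (ContinuousMonoidHom.id _)
      (resHomOfEquivariant (ContinuousMonoidHom.id _) Φ.proj hπ) z, fun g ↦ rfl, hq, fun v 𝔓 h𝔓 ↦ ?_⟩
    exact hqloc _ (hmem v 𝔓 h𝔓)
  · exact Or.inr ⟨w, m₁, hw, fun v 𝔓 h𝔓 ↦ hwloc _ (hmem v 𝔓 h𝔓), hwz⟩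

/-! ## §2 Hand-off: an everywhere-unramified non-zero class as a non-zero equivariant homomorphism on `N` -/

section HandOff

variable {F : Type} [Field F] [NumberField F] {p : ℕ} [hp : Fact p.Prime]
variable {A : Type} [AddCommGroup A] [DistribMulAction (absoluteGaloisGroup F) A] [TopologicalSpace A]
  [DiscreteTopology A]

omit [NumberField F] in
/-- **The hand-off to the engines' currency.** `A` a discrete `Γ_F`-module of PRIME order `p` with continuous
orbit maps on which `Γ_F` acts non-trivially, `N = ker(Γ_F → Aut A)`; `w : Γ_F → A` a continuous crossed
homomorphism with NON-ZERO class which is a coboundary on the inertia group `I_𝔓` of every prime `𝔓` of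
`\bar ℤ_F`. Then `w` is continuous, additive on `N`, `Γ_F`-equivariant on `N` (`w(g n g⁻¹) = g • w(n)`), kills
`N ∩ I_𝔓` for every `𝔓`, and does NOT vanish identically on `N` (restriction `H¹(Γ_F, A) → H¹(N, A)` is
injective, T2). This is the negation of the conclusion of the herbrand line's `ODD(r, N)` / `EVEN` statements
for the character of `A`. [cite: SerreGaloisCohomology1997, I.§2.6 (b) and I.§5.1] [cite: GreenbergLNM1716, §3 (PDF p. 86)] -/
theorem hom_of_unramified_class (hcard : Nat.card A = p)
    (hcont : ∀ a : A, Continuous fun g : absoluteGaloisGroup F ↦ g • a)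
    (hnt : ∃ (g : absoluteGaloisGroup F) (a : A), g • a ≠ a)
    (w : contOneCocycles (discreteTopRep (absoluteGaloisGroup F) A)) (hw : oneCocycleClass _ w ≠ 0)
    (hwI : ∀ (v : HeightOneSpectrum (𝓞 F)) (𝔓 : Ideal (absIntegers (𝓞 F) F)), 𝔓 ∈ v.primesAbove →
      ∃ a : A, ∀ g ∈ 𝔓.inertia (absoluteGaloisGroup F), w.1 g = g • a - a) :
    Continuous w.1 ∧
      (∀ a ∈ (MulAction.toPermHom (absoluteGaloisGroup F) A).ker,
        ∀ b ∈ (MulAction.toPermHom (absoluteGaloisGroup F) A).ker, w.1 (a * b) = w.1 a + w.1 b) ∧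
      (∀ (g : absoluteGaloisGroup F), ∀ n ∈ (MulAction.toPermHom (absoluteGaloisGroup F) A).ker,
        w.1 (g * n * g⁻¹) = g • w.1 n) ∧
      (∀ (v : HeightOneSpectrum (𝓞 F)) (𝔓 : Ideal (absIntegers (𝓞 F) F)), 𝔓 ∈ v.primesAbove →
        ∀ n ∈ (MulAction.toPermHom (absoluteGaloisGroup F) A).ker,
          n ∈ 𝔓.inertia (absoluteGaloisGroup F) → w.1 n = 0) ∧
      ∃ n ∈ (MulAction.toPermHom (absoluteGaloisGroup F) A).ker, w.1 n ≠ 0 := by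
  have hker : ∀ n : absoluteGaloisGroup F, n ∈ (MulAction.toPermHom (absoluteGaloisGroup F) A).ker →
      ∀ a : A, n • a = a := fun n hn ↦ (HerbrandLineRestriction.mem_ker_toPermHom_iff n).1 hn
  refine ⟨w.1.continuous, fun a ha b _ ↦ HerbrandSelmerToHom.cocycle_apply_mul_of_forall_smul_eq w (hker a ha) b,
    fun g n hn ↦ HerbrandSelmerToHom.cocycle_apply_conj_of_forall_smul_eq w g (hker n hn),
    fun v 𝔓 h𝔓 n hn hnI ↦ ?_, ?_⟩
  · obtain ⟨a, ha⟩ := hwI v 𝔓 h𝔓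
    exact apply_eq_zero_of_coboundaryOn_of_forall_smul_eq w ha hnI (hker n hn)
  · by_contra hall
    push Not at hall
    apply hw
    exact HerbrandSelmerToHom.oneCocycleClass_eq_zero_of_forall_apply_eq_zero _
      (HerbrandLineRestriction.subgroupResKer_ker_eq_bot_of_card_prime hcard hcont hnt) w
      fun n ↦ hall n.1 n.2

end HandOff

end Summit.BirchSwinnertonDyer.BirchSwinnertonDyer.Theorems.PrintCFram.LevelDictionary

end
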